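import Summits.QuantumAdvantage.QuantumAdvantage.Theorems.CubicForrelationNearExactIsExactFlatL1
import Summits.QuantumAdvantage.QuantumAdvantage.Theorems.CubicForrelationNearExactIsExactSixteenLevelEight

/-!
# Crux `CubicForrelation.NearExactIsExact` (stmt-QuantumAdvantage-14043) — n = 16, TWO-SIDED: the level-7 boundary configuration is not
  realizable (`W_g ∈ 128ℤ` and `Φ ≥ 31/32` force `Φ = 1`)

Certificate seat `b2b-cforr-cert` (gen 6).  HONEST FRAMING: a theorem about cubic Boolean functions on 16 bits (the finite slice `n = 16` of
the crux) — the boundary configuration (b) "level 7" of the certified bound `θ₁₆ ≤ 31/32` is excluded two-sidedly; NOT summit progress and NOT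
yet the full statement `Φ ≥ 31/32 ⇒ Φ = 1` on 16 bits (the split configurations remain; see the gen-4 write-up).

`sl_levelSeven_ge`: for cubic `f, g : 𝔽₂¹⁶ → 𝔽₂` with `W_g = 128·u'` (all Walsh values divisible by `2⁷`) and `Φ(f,g) ≥ 31/32`: `Φ(f,g) = 1`.
Proof.  If every `u'` is even we are at level 8 (`se_levelEight_ge`).  Otherwise `p = [u' odd]` is quadratic (tower), the two-sided budget
`Σ(u − 4s)² = 4Σ(u' − 2s)² = 2²¹(1−Φ) ≤ 2¹⁶` (`s = (−1)^f`, `u = 2u'`) pays `≥ 1` per odd point and `RM(2,16)` gives `#P ≥ 2¹⁴`: so `#P = 2¹⁴`,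
`P = {u' odd}` is a 14-FLAT `x₁ ⊕ V₀` (`mw_flat_of_minweight`), `u' = 2s` off `P`, `e := u' − 2s = ±1` on `P`, and `Φ = 31/32` exactly.
General 5- and 6-flat sums (`fs_flat_sum_dvd`: `8 ∣ Σ₅ u`, `16 ∣ Σ₆ u`; `16 ∣ 4Σ s`) over an inner 3- or 4-flat of `P` plus two directions
`t₁, t₂` with `t₁, t₂, t₁⊕t₂ ∉ V₀` (the translates lie off `P`, where `u − 4s = 0`) show that `e` has all 3-flat sums `≡ 0 (4)` and all 4-flat
sums `≡ 0 (8)` inside `P`; the engine `fl1_flat_l1` (rank `≤ 2` along the flat, periods pin the spectrum) gives `Σ_y |(e1_P)^(y)| ≤ 2¹⁷`.  But the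
pairing identity `Σ_y (−1)^{g(y)} (u − 4s)^(y) = 2²⁶(1 − Φ) = 2²¹` (`sl_pairing16`) needs `Σ_y |(e1_P)^| ≥ 2²⁰`. Contradiction.

References: J. Ax (1964) / R. J. McEliece (1972); MacWilliams–Sloane (1977) Ch. 13–15; R. O'Donnell (2014) §3.3; S. Aaronson, A. Ambainis,
SIAM J. Comput. 47 (2018) §1.1.1.  Everything below is proved from Mathlib and the tree; axioms are the standard three.
-/

set_option linter.dupNamespace false -- D-0017: single-problem summit ⇒ `QuantumAdvantage.QuantumAdvantage` by design

noncomputable section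

namespace Summit.QuantumAdvantage.QuantumAdvantage.Theorems.CubicForrelation.NearExactIsExact

open Finset
open Literature.Computability.QuantumComplexity
open Literature.Computability.QuantumComplexity.BuzetChailloux (bxor zeroVec bxor_bxor_cancel_left bxor_zeroVec zeroVec_bxor bxor_comm
  bxor_self signOf_sq)
open Literature.Computability.QuantumComplexity.DerivativeWalsh (W sum_W_sq)

variable {n : ℕ}

/-! ### Two small general tools -/

/-- **Ax on a parametrised `k`-flat, integer form**: for cubic `F` on `n` bits, `Σ_ε sZ(F(b ⊕ a_ε)) = 2^{⌈k/3⌉}·z`. [cite: Carlet2020, §4.1] -/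
theorem sl_sum_sZ_flat {k : ℕ} (F : (Fin n → Bool) → Bool) (hF : IsDegLeFun 3 F) (b : Fin n → Bool) (a : Fin k → Fin n → Bool) :
    ∃ z : ℤ, ∑ ε : Fin k → Bool, sZ (F (fun j => b j ^^ decide (Odd #(univ.filter fun i => ε i && a i j)))) =
      2 ^ ((k + 2) / 3) * z := by
  obtain ⟨z, hz⟩ := fs_sum_signOf_flat_dvd F hF b a
  refine ⟨z, ?_⟩
  have h : ((∑ ε : Fin k → Bool, sZ (F (fun j => b j ^^ decide (Odd #(univ.filter fun i => ε i && a i j)))) : ℤ) : ℝ) =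
      (((2 : ℤ) ^ ((k + 2) / 3) * z : ℤ) : ℝ) := by
    push_cast
    rw [sum_congr rfl fun ε _ => tp_sZ_cast _, hz]
  exact_mod_cast h

/-- **The two-sided pairing identity on 16 bits.** With `W_g = 64u`: `Σ_y (−1)^{g(y)}·(u − 4(−1)^f)^(y) = 2²⁶·(1 − Φ(f,g))`
(`= Σ_x (u − 4s)(x)·W_g(x) = 64Σu² − 4·2²⁴Φ`). [this work] -/
theorem sl_pairing16 (f g : (Fin (8 + 8) → Bool) → Bool) (u : (Fin (8 + 8) → Bool) → ℤ)
    (hu : ∀ x, W (fun y => signOf (g y)) x = (2 : ℝ) ^ 6 * (u x : ℝ)) :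
    ∑ y, signOf (g y) * W (fun x => (u x : ℝ) - 4 * signOf (f x)) y = (2 : ℝ) ^ 26 * (1 - forrelation f g) := by
  rw [fl1_pairing]
  have hΦ := vg_two_pow_mul_forrelation f g
  have hsq : ∑ x, ((u x : ℝ)) ^ 2 = 2 ^ 20 := by exact_mod_cast sx_sum_u_sq g u hu
  have e : ∀ x, ((u x : ℝ) - 4 * signOf (f x)) * W (fun y => signOf (g y)) x =
      64 * (u x : ℝ) ^ 2 - 4 * (signOf (f x) * W (fun y => signOf (g y)) x) := by
    intro x; rw [hu x]; ring
  rw [sum_congr rfl fun x _ => e x, sum_sub_distrib, ← mul_sum, ← mul_sum, hsq, ← hΦ]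
  norm_num
  ring

/-! ### The level-7 exclusion -/

/-- **Level 7 on 16 bits: `Φ ≥ 31/32 ⇒ Φ = 1`.**  For cubic `f, g : 𝔽₂¹⁶ → 𝔽₂` with `W_g = 128·u'` and `Φ(f,g) ≥ 31/32` the pair is exact
(level 8: `se_levelEight_ge`; genuine level 7: the odd set of `u'` would be a 14-flat carrying a sign pattern `u' − 2(−1)^f` of rank `≤ 2`
along the flat, whose few large frequencies cannot supply the pairing `2²¹`).  Finite-slice statement; NOT summit progress. [this work] -/
theorem sl_levelSeven_ge (f g : (Fin (8 + 8) → Bool) → Bool) (hf : IsDegLeFun 3 f) (hg : IsDegLeFun 3 g)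
    (u' : (Fin (8 + 8) → Bool) → ℤ) (hu' : ∀ x, W (fun y => signOf (g y)) x = (2 : ℝ) ^ 7 * (u' x : ℝ))
    (hΦ : (31 / 32 : ℝ) ≤ forrelation f g) : forrelation f g = 1 := by
  classical
  -- level 8
  by_cases hall : ∀ x, ¬ Odd (u' x)
  · have hw : ∀ x, W (fun y => signOf (g y)) x = (2 : ℝ) ^ 8 * (((u' x / 2 : ℤ)) : ℝ) := by
      intro x
      rw [hu' x]
      obtain ⟨k, hk⟩ := Int.not_odd_iff_even.1 (hall x)
      rw [hk, show k + k = 2 * k by ring, Int.mul_ediv_cancel_left k (by norm_num : (2 : ℤ) ≠ 0)]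
      push_cast
      ring
    exact se_levelEight_ge f g hf hg _ hw hΦ
  exfalso
  push Not at hall
  obtain ⟨x₁, hx₁⟩ := hall
  -- `u = 2u'` at the Ax level `6`
  set u : (Fin (8 + 8) → Bool) → ℤ := fun x => 2 * u' x with hudef
  have hu : ∀ x, W (fun y => signOf (g y)) x = (2 : ℝ) ^ 6 * (u x : ℝ) := by
    intro x; rw [hu' x]; simp only [u]; push_cast; ring
  -- the parity of `u'` is quadratic
  have hp : IsDegLeFun 2 (fun x => decide (Odd (u' x))) :=
    stub_walshTower stub_axParity (8 + 8) 7 2 g u' hg hu' (by intro k hk hkn; omega)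
  have hp' : IsDegLeFun (1 + 1) (fun x => decide (Odd (u' x))) := hp
  -- budget `Σ (u' − 2s)² ≤ 2¹⁴`
  have hbud := st_budget6 f g u hu
  have hB : (∑ x, (u' x - 2 * sZ (f x)) ^ 2 : ℤ) ≤ 2 ^ 14 := by
    have h4 : ∀ x, (u x - 4 * sZ (f x)) ^ 2 = 4 * (u' x - 2 * sZ (f x)) ^ 2 := fun x => by simp only [u]; ring
    have h' : ((∑ x, (u x - 4 * sZ (f x)) ^ 2 : ℤ) : ℝ) ≤ 2 ^ 16 := by rw [hbud]; nlinarith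
    have h'' : (∑ x, (u x - 4 * sZ (f x)) ^ 2 : ℤ) ≤ 2 ^ 16 := by exact_mod_cast h'
    rw [sum_congr rfl fun x _ => h4 x, ← mul_sum] at h''
    linarith
  -- RM: `#P ≥ 2¹⁴`
  have hRM := bb_rmWeight_holds (8 + 8) 2 (fun x => decide (Odd (u' x))) hp ⟨x₁, by simpa using hx₁⟩
  have hfilt : (univ.filter fun x : Fin (8 + 8) → Bool => decide (Odd (u' x)) = true) = univ.filter fun x => Odd (u' x) :=
    filter_congr fun x _ => by simp
  have hPge : 2 ^ 14 ≤ #(univ.filter fun x : Fin (8 + 8) → Bool => Odd (u' x)) := by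
    rw [hfilt] at hRM
    have h2 : (2 : ℕ) ^ (8 + 8) = 4 * 2 ^ 14 := by norm_num
    rw [h2, show (2 : ℕ) ^ 2 = 4 by norm_num] at hRM
    omega
  -- pointwise: cost `1` at odd points is met exactly, nothing else is spent
  have hsumP : (∑ x, (if Odd (u' x) then 1 else 0 : ℤ)) = #(univ.filter fun x : Fin (8 + 8) → Bool => Odd (u' x)) := by
    rw [sum_boole]
  have hnonneg : ∀ x, 0 ≤ (u' x - 2 * sZ (f x)) ^ 2 - (if Odd (u' x) then 1 else 0 : ℤ) := by
    intro x
    by_cases h : Odd (u' x)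
    · rw [if_pos h]
      have h0 := Int.odd_iff.1 h
      have : u' x - 2 * sZ (f x) ≤ -1 ∨ 1 ≤ u' x - 2 * sZ (f x) := by
        rcases tp_sZ_cases (f x) with hs | hs <;> rw [hs] <;> omega
      have := tp_sq_ge (k := 1) (by norm_num) this
      linarith
    · rw [if_neg h]; have := sq_nonneg (u' x - 2 * sZ (f x)); linarith
  have hsum0 : ∑ x, ((u' x - 2 * sZ (f x)) ^ 2 - (if Odd (u' x) then 1 else 0 : ℤ)) = 0 := by
    refine le_antisymm ?_ (sum_nonneg fun x _ => hnonneg x)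
    rw [sum_sub_distrib, hsumP]
    have : (2 : ℤ) ^ 14 ≤ #(univ.filter fun x : Fin (8 + 8) → Bool => Odd (u' x)) := by exact_mod_cast hPge
    linarith
  have hzero' : ∀ x, (u' x - 2 * sZ (f x)) ^ 2 - (if Odd (u' x) then 1 else 0 : ℤ) = 0 :=
    fun x => (sum_eq_zero_iff_of_nonneg fun y _ => hnonneg y).1 hsum0 x (mem_univ x)
  have hoff : ∀ x, ¬ Odd (u' x) → u' x - 2 * sZ (f x) = 0 := by
    intro x hx
    have h := hzero' x
    rw [if_neg hx, sub_zero] at h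
    exact (pow_eq_zero_iff two_ne_zero).1 h
  have hon : ∀ x, Odd (u' x) → u' x - 2 * sZ (f x) = 1 ∨ u' x - 2 * sZ (f x) = -1 := by
    intro x hx
    have h := hzero' x
    rw [if_pos hx] at h
    have h1 : (u' x - 2 * sZ (f x)) * (u' x - 2 * sZ (f x)) = 1 := by rw [← pow_two]; linarith
    exact mul_self_eq_one_iff.1 h1
  have hPcard : #(univ.filter fun x : Fin (8 + 8) → Bool => Odd (u' x)) = 2 ^ 14 := by
    have hle : (#(univ.filter fun x : Fin (8 + 8) → Bool => Odd (u' x)) : ℤ) ≤ 2 ^ 14 := by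
      rw [← hsumP]
      refine le_trans (sum_le_sum fun x _ => ?_) hB
      by_cases h : Odd (u' x)
      · rw [if_pos h]; rcases hon x h with h1 | h1 <;> rw [h1] <;> norm_num
      · rw [if_neg h]; positivity
    have hle' : #(univ.filter fun x : Fin (8 + 8) → Bool => Odd (u' x)) ≤ 2 ^ 14 := by exact_mod_cast hle
    omega
  -- hence `Φ = 31/32` exactly
  have hT : (∑ x, (u x - 4 * sZ (f x)) ^ 2 : ℤ) = 2 ^ 16 := by
    have h4 : ∀ x, (u x - 4 * sZ (f x)) ^ 2 = 4 * ((u' x - 2 * sZ (f x)) ^ 2 - (if Odd (u' x) then 1 else 0 : ℤ)) +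
        4 * (if Odd (u' x) then 1 else 0 : ℤ) := fun x => by simp only [u]; ring
    rw [sum_congr rfl fun x _ => h4 x, sum_add_distrib, ← mul_sum, ← mul_sum, hsum0, hsumP, hPcard]
    norm_num
  have hΦeq : forrelation f g = 31 / 32 := by
    have h : ((∑ x, (u x - 4 * sZ (f x)) ^ 2 : ℤ) : ℝ) = 2 ^ 16 := by exact_mod_cast hT
    rw [hbud] at h
    linarith
  -- the odd set is a 14-flat
  have hmw := mw_flat_of_minweight 1 (fun x => decide (Odd (u' x))) hp' (by rw [hfilt, hPcard]; norm_num)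
  rw [hfilt] at hmw
  obtain ⟨h0, hadd, hcardV, hcoset⟩ := hmw
  set V₀ := univ.filter (fun a : Fin (8 + 8) → Bool => ∀ x, decide (Odd (u' (bxor x a))) = decide (Odd (u' x))) with hV₀
  set S := univ.filter (fun x : Fin (8 + 8) → Bool => Odd (u' x)) with hSdef
  have hS : S = V₀.image (bxor x₁) := hcoset x₁ (by simpa using hx₁)
  have hmemS : ∀ x, x ∈ S ↔ Odd (u' x) := by intro x; simp [hSdef]
  -- two transversal directions
  have hcardV' : 2 * #V₀ < #(univ : Finset (Fin (8 + 8) → Bool)) := by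
    rw [hcardV, hPcard, card_univ, Fintype.card_fun, Fintype.card_bool, Fintype.card_fin]; norm_num
  obtain ⟨t₁, -, t₂, -, ht₁, ht₂, ht₁₂, ht₂₁⟩ := fl1_dirs2 univ V₀ hcardV'
  -- the sign pattern `e = u' − 2s` and the residual `F = u − 4s = 2e`, vanishing off `S`
  set e : (Fin (8 + 8) → Bool) → ℤ := fun x => u' x - 2 * sZ (f x) with hedef
  have he : ∀ x ∈ S, e x = 1 ∨ e x = -1 := fun x hx => hon x ((hmemS x).1 hx)
  have hF0 : ∀ y, y ∉ S → u y - 4 * sZ (f y) = 0 := by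
    intro y hy
    have := hoff y (fun h => hy ((hmemS y).2 h))
    simp only [u]; linarith
  have hFe : ∀ y, u y - 4 * sZ (f y) = 2 * e y := fun y => by simp only [u, e]; ring
  -- localisation of a `(k+2)`-flat sum to the inner `k`-flat of `S`
  have hloc : ∀ {k : ℕ} (x : Fin (8 + 8) → Bool) (a : Fin k → Fin (8 + 8) → Bool),
      (∀ ε : Fin k → Bool, (fun j => x j ^^ decide (Odd #(univ.filter fun i => ε i && a i j))) ∈ S) →
      ∑ ε : Fin (k + 2) → Bool, (u (fun j => x j ^^ decide (Odd #(univ.filter fun i =>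
          ε i && (Matrix.vecCons t₁ (Matrix.vecCons t₂ a) : Fin (k + 2) → Fin (8 + 8) → Bool) i j))) -
        4 * sZ (f (fun j => x j ^^ decide (Odd #(univ.filter fun i =>
          ε i && (Matrix.vecCons t₁ (Matrix.vecCons t₂ a) : Fin (k + 2) → Fin (8 + 8) → Bool) i j))))) =
      ∑ ε : Fin k → Bool, 2 * e (fun j => x j ^^ decide (Odd #(univ.filter fun i => ε i && a i j))) := by
    intro k x a hin
    have p1 := fr_sum_peel (fun y => u y - 4 * sZ (f y)) x t₁ (Matrix.vecCons t₂ a)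
    beta_reduce at p1
    rw [p1]
    have p2 := fr_sum_peel (fun y => u y - 4 * sZ (f y)) x t₂ a
    beta_reduce at p2
    have p3 := fr_sum_peel (fun y => u (bxor y t₁) - 4 * sZ (f (bxor y t₁))) x t₂ a
    beta_reduce at p3
    rw [p2, p3]
    have z2 : ∑ ε : Fin k → Bool, (u (bxor (fun j => x j ^^ decide (Odd #(univ.filter fun i => ε i && a i j))) t₂) -
        4 * sZ (f (bxor (fun j => x j ^^ decide (Odd #(univ.filter fun i => ε i && a i j))) t₂))) = 0 :=
      sum_eq_zero fun ε _ => hF0 _ (fl1_coset_out h0 hadd hS (hin ε) ht₂)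
    have z1 : ∑ ε : Fin k → Bool, (u (bxor (fun j => x j ^^ decide (Odd #(univ.filter fun i => ε i && a i j))) t₁) -
        4 * sZ (f (bxor (fun j => x j ^^ decide (Odd #(univ.filter fun i => ε i && a i j))) t₁))) = 0 :=
      sum_eq_zero fun ε _ => hF0 _ (fl1_coset_out h0 hadd hS (hin ε) ht₁)
    have z21 : ∑ ε : Fin k → Bool, (u (bxor (bxor (fun j => x j ^^ decide (Odd #(univ.filter fun i => ε i && a i j))) t₂) t₁) -
        4 * sZ (f (bxor (bxor (fun j => x j ^^ decide (Odd #(univ.filter fun i => ε i && a i j))) t₂) t₁))) = 0 :=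
      sum_eq_zero fun ε _ => by
        rw [iw_bxor_assoc]
        exact hF0 _ (fl1_coset_out h0 hadd hS (hin ε) ht₂₁)
    rw [z2, z1, z21, add_zero, add_zero, add_zero]
    exact sum_congr rfl fun ε _ => hFe _
  have hPV : ∀ x, x ∈ S → ∀ a ∈ V₀, bxor x a ∈ S := fun x hx a ha => fl1_coset_vadd hadd hS hx ha
  -- (H3): 3-flat sums of `e` inside `S` are `≡ 0 (mod 4)`
  have H3 : ∀ x ∈ S, ∀ a b c : Fin (8 + 8) → Bool, a ∈ V₀ → b ∈ V₀ → c ∈ V₀ →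
      (4 : ℤ) ∣ ∑ ε : Fin 3 → Bool, e (fun j => x j ^^ decide (Odd #(univ.filter fun i =>
        ε i && (![a, b, c] : Fin 3 → Fin (8 + 8) → Bool) i j))) := by
    intro x hx a b c ha hb hc
    have hin : ∀ ε : Fin 3 → Bool, (fun j => x j ^^ decide (Odd #(univ.filter fun i =>
        ε i && (![a, b, c] : Fin 3 → Fin (8 + 8) → Bool) i j))) ∈ S :=
      fun ε => fr_mem_flatPt3 V₀ h0 (· ∈ S) hPV hx ![a, b, c] (fun i => by fin_cases i <;> assumption) ε
    have h8 := fs_flat_sum_dvd (e := 3) g u hg hu x ![t₁, t₂, a, b, c] (by norm_num)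
    obtain ⟨zf, hzf⟩ := sl_sum_sZ_flat f hf x ![t₁, t₂, a, b, c]
    have hzf' : ∑ ε : Fin 5 → Bool, 4 * sZ (f (fun j => x j ^^ decide (Odd #(univ.filter fun i =>
          ε i && (![t₁, t₂, a, b, c] : Fin 5 → Fin (8 + 8) → Bool) i j)))) = 8 * (2 * zf) := by
      rw [← mul_sum, hzf]; norm_num; ring
    have h8n : (8 : ℤ) ∣ ∑ ε : Fin 5 → Bool, u (fun j => x j ^^ decide (Odd #(univ.filter fun i =>
          ε i && (![t₁, t₂, a, b, c] : Fin 5 → Fin (8 + 8) → Bool) i j))) := by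
      have e8 : (2 : ℤ) ^ 3 = 8 := by norm_num
      rw [e8] at h8; exact h8
    have h8' : (8 : ℤ) ∣ ∑ ε : Fin 5 → Bool, (u (fun j => x j ^^ decide (Odd #(univ.filter fun i =>
          ε i && (![t₁, t₂, a, b, c] : Fin 5 → Fin (8 + 8) → Bool) i j))) -
        4 * sZ (f (fun j => x j ^^ decide (Odd #(univ.filter fun i =>
          ε i && (![t₁, t₂, a, b, c] : Fin 5 → Fin (8 + 8) → Bool) i j))))) := by
      rw [sum_sub_distrib, hzf']
      exact dvd_sub h8n (Dvd.intro _ rfl)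
    rw [hloc x ![a, b, c] hin, ← mul_sum] at h8'
    obtain ⟨k8, hk8⟩ := h8'
    exact ⟨k8, by linarith⟩
  -- (H4): 4-flat sums of `e` inside `S` are `≡ 0 (mod 8)`
  have H4 : ∀ x ∈ S, ∀ a₀ a₁ a₂ a₃ : Fin (8 + 8) → Bool, a₀ ∈ V₀ → a₁ ∈ V₀ → a₂ ∈ V₀ → a₃ ∈ V₀ →
      (8 : ℤ) ∣ ∑ ε : Fin 4 → Bool, e (fun j => x j ^^ decide (Odd #(univ.filter fun i =>
        ε i && (![a₀, a₁, a₂, a₃] : Fin 4 → Fin (8 + 8) → Bool) i j))) := by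
    intro x hx a₀ a₁ a₂ a₃ ha₀ ha₁ ha₂ ha₃
    have hin : ∀ ε : Fin 4 → Bool, (fun j => x j ^^ decide (Odd #(univ.filter fun i =>
        ε i && (![a₀, a₁, a₂, a₃] : Fin 4 → Fin (8 + 8) → Bool) i j))) ∈ S :=
      fun ε => fr_mem_flatPt4 V₀ h0 (· ∈ S) hPV hx ![a₀, a₁, a₂, a₃] (fun i => by fin_cases i <;> assumption) ε
    have h16 := fs_flat_sum_dvd (e := 4) g u hg hu x ![t₁, t₂, a₀, a₁, a₂, a₃] (by norm_num)
    obtain ⟨zf, hzf⟩ := sl_sum_sZ_flat f hf x ![t₁, t₂, a₀, a₁, a₂, a₃]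
    have hzf' : ∑ ε : Fin 6 → Bool, 4 * sZ (f (fun j => x j ^^ decide (Odd #(univ.filter fun i =>
          ε i && (![t₁, t₂, a₀, a₁, a₂, a₃] : Fin 6 → Fin (8 + 8) → Bool) i j)))) = 16 * zf := by
      rw [← mul_sum, hzf]; norm_num; ring
    have h16n : (16 : ℤ) ∣ ∑ ε : Fin 6 → Bool, u (fun j => x j ^^ decide (Odd #(univ.filter fun i =>
          ε i && (![t₁, t₂, a₀, a₁, a₂, a₃] : Fin 6 → Fin (8 + 8) → Bool) i j))) := by
      have e16 : (2 : ℤ) ^ 4 = 16 := by norm_num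
      rw [e16] at h16; exact h16
    have h16' : (16 : ℤ) ∣ ∑ ε : Fin 6 → Bool, (u (fun j => x j ^^ decide (Odd #(univ.filter fun i =>
          ε i && (![t₁, t₂, a₀, a₁, a₂, a₃] : Fin 6 → Fin (8 + 8) → Bool) i j))) -
        4 * sZ (f (fun j => x j ^^ decide (Odd #(univ.filter fun i =>
          ε i && (![t₁, t₂, a₀, a₁, a₂, a₃] : Fin 6 → Fin (8 + 8) → Bool) i j))))) := by
      rw [sum_sub_distrib, hzf']
      exact dvd_sub h16n (Dvd.intro _ rfl)
    rw [hloc x ![a₀, a₁, a₂, a₃] hin, ← mul_sum] at h16'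
    obtain ⟨k16, hk16⟩ := h16'
    exact ⟨k16, by linarith⟩
  -- the engine: few large frequencies
  have hE := fl1_flat_l1 V₀ S x₁ h0 hadd hS e he H3 H4
  set A : (Fin (8 + 8) → Bool) → ℝ := fun x => if x ∈ S then (e x : ℝ) else 0 with hA
  -- the pairing needs many: `Σ_y (−1)^g Â(y) = 2²⁰`
  have hAτ : (fun x => (u x : ℝ) - 4 * signOf (f x)) = fun x => 2 * A x := by
    funext x
    have h2 : (u x : ℝ) - 4 * signOf (f x) = (((u x - 4 * sZ (f x) : ℤ)) : ℝ) := by push_cast; rw [tp_sZ_cast]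
    rw [h2]
    by_cases hx : x ∈ S
    · simp only [A, if_pos hx]; rw [hFe x]; push_cast; ring
    · simp only [A, if_neg hx]; rw [hF0 x hx]; norm_num
  have hpair := sl_pairing16 f g u hu
  rw [hΦeq, hAτ] at hpair
  have hpair' : ∑ y, signOf (g y) * W A y = 2 ^ 20 := by
    have e2 : ∀ y, signOf (g y) * W (fun x => 2 * A x) y = 2 * (signOf (g y) * W A y) := fun y => by
      rw [fl1_W_smul]; ring
    have h26 : (2 : ℝ) ^ 26 * (1 - 31 / 32) = 2 * 2 ^ 20 := by norm_num
    rw [sum_congr rfl fun y _ => e2 y, ← mul_sum, h26] at hpair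
    linarith
  have hge : (2 : ℝ) ^ 20 ≤ ∑ y, |W A y| := by rw [← hpair']; exact fl1_pairing_le_l1 g (W A)
  -- `(2²⁰)² ≤ (Σ|Â|)² ≤ 4·2³²`
  have hsq : ((2 : ℝ) ^ 20) ^ 2 ≤ (∑ y, |W A y|) ^ 2 := pow_le_pow_left₀ (by positivity) hge 2
  norm_num at hE hsq
  linarith

end Summit.QuantumAdvantage.QuantumAdvantage.Theorems.CubicForrelation.NearExactIsExact

end
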